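import Mathlib
import HarnessLib
import Summits.ValiantsHypothesis.ValiantsHypothesis.Theorems.SchenstedIndexThetaBlockCoeff
import Summits.ValiantsHypothesis.ValiantsHypothesis.Theorems.SchenstedIndexSlotRelabelling

/-!
# Route SchenstedIndex — from a balanced polynomial on coefficient space to a label-consistent
# functional on block partitions (step (d) of the completeness transfer for `BorderPcPerThree`,
# stmt-ValiantsHypothesis-16085)

Slots `S = Fin t × L`, labels `s ↦ s.2`, polarisation `θ : x_ℓ ↦ ∑_k y_(k,ℓ)`, block functional
`E(f)(π) = ∏_(B ∈ π) coeff_(1_B) (θ f)` on the `m`-block partitions `π` of `S`.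

* `prod_coeff_indicator_theta_eq` — `E(f)(π) = μ_π · (∏_(B ∈ π) c_(α_B))(f)`: the block functional at `π`
  is a nonzero multiple (`μ_π ≠ 0`, `coeff_indicator_theta_monomial_self_ne_zero`) of the MONOMIAL
  `∏_B c_(α_B)` in the coefficients of `f`, `α_B` the label multiset of `B` (`coeff_indicator_theta`);
* `prod_coeff_indicator_theta_mapPermSub` — `E(f)(g • π) = E(f)(π)` for label-preserving slot
  permutations `g` (`θ f` is fixed by `rename g`, `theta_rename_labelPreserving`);
* **`exists_labelConsistent_functional`** — if every monomial of a polynomial `q` on coefficient space is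
  the label-multiset monomial of some `m`-block partition, then there is a functional `a` on block
  partitions, invariant under label-preserving slot permutations, with
  `∑_π a(π) E(f)(π) = c · q(coeffVec f)` for all `f` and a constant `c ≠ 0` (choose one partition per
  monomial, divide by `μ_π`, symmetrise over the label-preserving permutations).

Route-independent file.  HONEST FRAMING: bookkeeping for an OPEN support item; nothing on `VP ≠ VNP`.
-/

set_option linter.dupNamespace false

noncomputable section

namespace Summit.ValiantsHypothesis.ValiantsHypothesis.Theorems.SchenstedIndex

open MvPolynomial
open Literature.Computability.AlgebraicComplexity

/-! ## The block functional reads a monomial in the coefficients -/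

/-- `E(f)(π) = μ_π · ∏_(B ∈ π) coeff_(α_B) f`, the latter written as the evaluation of the monomial
`∏_B c_(α_B)` at the coefficient vector of `f`. -/
theorem prod_coeff_indicator_theta_eq {t : ℕ} {L : Type*} [Fintype L] [DecidableEq L]
    (P : Finset (Finset (Fin t × L))) (f : MvPolynomial L ℂ) :
    ∏ B ∈ P, coeff (∑ s ∈ B, Finsupp.single s 1)
        (aeval (fun ℓ : L => ∑ k : Fin t, (X (k, ℓ) : MvPolynomial (Fin t × L) ℂ)) f) =
      (∏ B ∈ P, coeff (∑ s ∈ B, Finsupp.single s 1)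
          (aeval (fun ℓ : L => ∑ k : Fin t, (X (k, ℓ) : MvPolynomial (Fin t × L) ℂ))
            (monomial (∑ s ∈ B, Finsupp.single s.2 1) (1 : ℂ)))) *
        eval (coeffVec f) (monomial
          (∑ B ∈ P, Finsupp.single (∑ s ∈ B, Finsupp.single s.2 1) 1) (1 : ℂ)) := by
  classical
  rw [Finset.prod_congr rfl (fun B _ => coeff_indicator_theta B f), Finset.prod_mul_distrib]
  congr 1
  rw [eval_monomial, one_mul, ← Finsupp.prod_finsetSum_index (fun d => pow_zero _)
    (fun d k₁ k₂ => pow_add _ _ _)]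
  refine Finset.prod_congr rfl fun B _ => ?_
  rw [Finsupp.prod_single_index (h := fun d k => coeffVec f d ^ k) (pow_zero _), pow_one,
    coeffVec_apply]

/-! ## Invariance under label-preserving slot permutations -/

/-- `θ f` is fixed by every label-preserving permutation of the slots. -/
theorem theta_rename_labelPreserving {t : ℕ} {L : Type*} [Fintype L] [DecidableEq L]
    (g : Equiv.Perm (Fin t × L)) (hg : ∀ s, (g s).2 = s.2) (f : MvPolynomial L ℂ) :
    rename g (aeval (fun ℓ : L => ∑ k : Fin t, (X (k, ℓ) : MvPolynomial (Fin t × L) ℂ)) f) =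
      aeval (fun ℓ : L => ∑ k : Fin t, (X (k, ℓ) : MvPolynomial (Fin t × L) ℂ)) f := by
  classical
  have h1 : ∀ (ℓ : L) (φ : Fin t × L → MvPolynomial (Fin t × L) ℂ),
      (∑ s : Fin t × L, if s.2 = ℓ then φ s else 0) = ∑ k : Fin t, φ (k, ℓ) := by
    intro ℓ φ
    rw [Fintype.sum_prod_type]
    refine Finset.sum_congr rfl fun k _ => ?_
    rw [Finset.sum_ite_eq' Finset.univ ℓ (fun l => φ (k, l)), if_pos (Finset.mem_univ _)]
  have hfun : (fun ℓ : L => rename g (∑ k : Fin t, (X (k, ℓ) : MvPolynomial (Fin t × L) ℂ))) =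
      fun ℓ : L => ∑ k : Fin t, (X (k, ℓ) : MvPolynomial (Fin t × L) ℂ) := by
    funext ℓ
    rw [map_sum]
    simp only [rename_X]
    rw [← h1 ℓ (fun s => X (g s)), ← h1 ℓ (fun s => X s)]
    calc (∑ s : Fin t × L, if s.2 = ℓ then (X (g s) : MvPolynomial (Fin t × L) ℂ) else 0)
        = ∑ s : Fin t × L, if (g s).2 = ℓ then (X (g s) : MvPolynomial (Fin t × L) ℂ) else 0 :=
          Finset.sum_congr rfl fun s _ => by rw [hg s]
      _ = ∑ s : Fin t × L, if s.2 = ℓ then (X s : MvPolynomial (Fin t × L) ℂ) else 0 :=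
          Equiv.sum_comp g (fun s => if s.2 = ℓ then (X s : MvPolynomial (Fin t × L) ℂ) else 0)
  rw [← AlgHom.comp_apply, comp_aeval, hfun]

/-- Block coefficients of `θ f` are unchanged when the block is moved by a label-preserving slot
permutation. -/
theorem coeff_indicator_map_theta {t : ℕ} {L : Type*} [Fintype L] [DecidableEq L]
    (g : Equiv.Perm (Fin t × L)) (hg : ∀ s, (g s).2 = s.2) (f : MvPolynomial L ℂ)
    (A : Finset (Fin t × L)) :
    coeff (∑ s ∈ A.map g.toEmbedding, Finsupp.single s 1)
        (aeval (fun ℓ : L => ∑ k : Fin t, (X (k, ℓ) : MvPolynomial (Fin t × L) ℂ)) f) =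
      coeff (∑ s ∈ A, Finsupp.single s 1)
        (aeval (fun ℓ : L => ∑ k : Fin t, (X (k, ℓ) : MvPolynomial (Fin t × L) ℂ)) f) := by
  classical
  conv_lhs => rw [← theta_rename_labelPreserving g hg f]
  have hmap : (∑ s ∈ A.map g.toEmbedding, Finsupp.single s 1 : (Fin t × L) →₀ ℕ) =
      Finsupp.mapDomain g (∑ s ∈ A, Finsupp.single s 1) := by
    rw [Finsupp.mapDomain_finsetSum, Finset.sum_map]
    simp only [Finsupp.mapDomain_single]
    rfl
  rw [hmap, coeff_rename_mapDomain g g.injective]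

/-- **`E(f)(g • π) = E(f)(π)`** for label-preserving slot permutations `g`. -/
theorem prod_coeff_indicator_theta_mapPermSub {t m : ℕ} {L : Type*} [Fintype L] [DecidableEq L]
    (g : Equiv.Perm (Fin t × L)) (hg : ∀ s, (g s).2 = s.2)
    (π : {π : Finpartition (Finset.univ : Finset (Fin t × L)) // ∀ B ∈ π.parts, B.card = m})
    (f : MvPolynomial L ℂ) :
    ∏ B ∈ (mapPermSub g π).1.parts, coeff (∑ s ∈ B, Finsupp.single s 1)
        (aeval (fun ℓ : L => ∑ k : Fin t, (X (k, ℓ) : MvPolynomial (Fin t × L) ℂ)) f) =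
      ∏ B ∈ π.1.parts, coeff (∑ s ∈ B, Finsupp.single s 1)
        (aeval (fun ℓ : L => ∑ k : Fin t, (X (k, ℓ) : MvPolynomial (Fin t × L) ℂ)) f) := by
  show ∏ B ∈ (mapPerm g π.1).parts, _ = _
  rw [mapPerm_parts, Finset.prod_map]
  refine Finset.prod_congr rfl fun A _ => ?_
  exact coeff_indicator_map_theta g hg f A

/-- `mapPermSub` is an action: `g • (h • π) = (h.trans g) • π`. -/
theorem mapPermSub_mapPermSub {S : Type*} [Fintype S] [DecidableEq S] {m : ℕ} (g h : Equiv.Perm S)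
    (π : {π : Finpartition (Finset.univ : Finset S) // ∀ B ∈ π.parts, B.card = m}) :
    mapPermSub g (mapPermSub h π) = mapPermSub (h.trans g) π := by
  apply Subtype.ext
  apply Finpartition.ext
  show (π.1.parts.map h.finsetCongr.toEmbedding).map g.finsetCongr.toEmbedding =
    π.1.parts.map (h.trans g).finsetCongr.toEmbedding
  rw [Finset.map_map]
  congr 1
  refine Function.Embedding.ext fun A => ?_
  show (A.map h.toEmbedding).map g.toEmbedding = A.map (h.trans g).toEmbedding
  rw [Finset.map_map]
  rfl

/-! ## The label-consistent functional -/

/-- **Step (d) of the completeness transfer.** If every monomial of `q` (a polynomial on the coefficient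
space of `ℂ[x_ℓ : ℓ ∈ L]`) is the label-multiset monomial `∏_(B ∈ π) c_(α_B)` of some `m`-block
partition `π` of the slots `Fin t × L`, then some functional `a` on the `m`-block partitions, invariant
under the label-preserving slot permutations, has `∑_π a(π) · E(f)(π) = c · q(coeffVec f)` for every `f`,
with a constant `c ≠ 0`. -/
theorem exists_labelConsistent_functional {t m : ℕ} {L : Type*} [Fintype L] [DecidableEq L]
    (q : MvPolynomial (L →₀ ℕ) ℂ)
    (hq : ∀ e ∈ q.support,
      ∃ π : {π : Finpartition (Finset.univ : Finset (Fin t × L)) // ∀ B ∈ π.parts, B.card = m},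
        (∑ B ∈ π.1.parts, Finsupp.single (∑ s ∈ B, Finsupp.single s.2 1) 1 :
          (L →₀ ℕ) →₀ ℕ) = e) :
    ∃ a : {π : Finpartition (Finset.univ : Finset (Fin t × L)) // ∀ B ∈ π.parts, B.card = m} → ℂ,
      (∀ g : Equiv.Perm (Fin t × L), (∀ s, (g s).2 = s.2) → ∀ π, a (mapPermSub g π) = a π) ∧
      ∃ c : ℂ, c ≠ 0 ∧ ∀ f : MvPolynomial L ℂ,
        ∑ π : {π : Finpartition (Finset.univ : Finset (Fin t × L)) // ∀ B ∈ π.parts, B.card = m},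
          a π * ∏ B ∈ π.1.parts, coeff (∑ s ∈ B, Finsupp.single s 1)
            (aeval (fun ℓ : L => ∑ k : Fin t, (X (k, ℓ) : MvPolynomial (Fin t × L) ℂ)) f) =
        c * aeval (coeffVec f) q := by
  classical
  have haev : ∀ (v : (L →₀ ℕ) → ℂ) (x : MvPolynomial (L →₀ ℕ) ℂ), aeval v x = eval v x :=
    fun v x => rfl
  choose πe hπe using hq
  -- the universal constants `μ_π ≠ 0`
  set μ : {π : Finpartition (Finset.univ : Finset (Fin t × L)) // ∀ B ∈ π.parts, B.card = m} → ℂ :=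
    fun π => ∏ B ∈ π.1.parts, coeff (∑ s ∈ B, Finsupp.single s 1)
      (aeval (fun ℓ : L => ∑ k : Fin t, (X (k, ℓ) : MvPolynomial (Fin t × L) ℂ))
        (monomial (∑ s ∈ B, Finsupp.single s.2 1) (1 : ℂ))) with hμ
  have hμ0 : ∀ π, μ π ≠ 0 := fun π =>
    Finset.prod_ne_zero_iff.mpr fun B hB => coeff_indicator_theta_monomial_self_ne_zero B (π.2 B hB)
  -- the raw functional: one partition per monomial
  set a₀ : {π : Finpartition (Finset.univ : Finset (Fin t × L)) // ∀ B ∈ π.parts, B.card = m} → ℂ :=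
    fun π => ∑ e ∈ q.support.attach,
      if π = πe e.1 e.2 then coeff e.1 q / μ (πe e.1 e.2) else 0 with ha₀
  have hpair₀ : ∀ f : MvPolynomial L ℂ,
      ∑ π : {π : Finpartition (Finset.univ : Finset (Fin t × L)) // ∀ B ∈ π.parts, B.card = m},
        a₀ π * ∏ B ∈ π.1.parts, coeff (∑ s ∈ B, Finsupp.single s 1)
          (aeval (fun ℓ : L => ∑ k : Fin t, (X (k, ℓ) : MvPolynomial (Fin t × L) ℂ)) f) =
        eval (coeffVec f) q := by
    intro f
    simp only [ha₀, Finset.sum_mul]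
    rw [Finset.sum_comm]
    have hterm : ∀ e ∈ q.support.attach,
        ∑ π : {π : Finpartition (Finset.univ : Finset (Fin t × L)) // ∀ B ∈ π.parts, B.card = m},
          (if π = πe e.1 e.2 then coeff e.1 q / μ (πe e.1 e.2) else 0) *
            ∏ B ∈ π.1.parts, coeff (∑ s ∈ B, Finsupp.single s 1)
              (aeval (fun ℓ : L => ∑ k : Fin t, (X (k, ℓ) : MvPolynomial (Fin t × L) ℂ)) f) =
          coeff e.1 q * eval (coeffVec f) (monomial e.1 (1 : ℂ)) := by
      intro e _
      simp_rw [ite_mul, zero_mul]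
      rw [Finset.sum_ite_eq' Finset.univ (πe e.1 e.2), if_pos (Finset.mem_univ _),
        prod_coeff_indicator_theta_eq, hπe e.1 e.2]
      have hμe : μ (πe e.1 e.2) ≠ 0 := hμ0 _
      rw [hμ]  at hμe ⊢
      field_simp
    rw [Finset.sum_congr rfl hterm,
      Finset.sum_attach q.support (fun e => coeff e q * eval (coeffVec f) (monomial e (1 : ℂ)))]
    conv_rhs => rw [← q.support_sum_monomial_coeff, map_sum]
    refine Finset.sum_congr rfl fun e _ => ?_
    rw [eval_monomial, eval_monomial, one_mul]
  -- symmetrisation over the label-preserving slot permutations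
  set a : {π : Finpartition (Finset.univ : Finset (Fin t × L)) // ∀ B ∈ π.parts, B.card = m} → ℂ :=
    fun π => ∑ g : {g : Equiv.Perm (Fin t × L) // ∀ s, (g s).2 = s.2}, a₀ (mapPermSub g.1 π)
    with ha
  refine ⟨a, ?_, (Fintype.card {g : Equiv.Perm (Fin t × L) // ∀ s, (g s).2 = s.2} : ℂ), ?_, ?_⟩
  · -- invariance
    intro h hh π
    simp only [ha, mapPermSub_mapPermSub]
    let φ : {g : Equiv.Perm (Fin t × L) // ∀ s, (g s).2 = s.2} ≃
        {g : Equiv.Perm (Fin t × L) // ∀ s, (g s).2 = s.2} :=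
      { toFun := fun g => ⟨h.trans g.1, fun s => by rw [Equiv.trans_apply, g.2, hh]⟩
        invFun := fun g => ⟨h.symm.trans g.1, fun s => by
          rw [Equiv.trans_apply, g.2]
          conv_rhs => rw [← h.apply_symm_apply s]
          rw [hh]⟩
        left_inv := fun g => Subtype.ext (Equiv.ext fun s => by simp)
        right_inv := fun g => Subtype.ext (Equiv.ext fun s => by simp) }
    exact Fintype.sum_equiv φ _ _ (fun g => rfl)
  · -- `c ≠ 0`
    exact Nat.cast_ne_zero.mpr (Fintype.card_pos_iff.mpr ⟨⟨Equiv.refl _, fun s => rfl⟩⟩).ne'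
  · -- the pairing
    intro f
    rw [haev]
    simp only [ha, Finset.sum_mul]
    rw [Finset.sum_comm]
    have hg : ∀ g : {g : Equiv.Perm (Fin t × L) // ∀ s, (g s).2 = s.2},
        ∑ π : {π : Finpartition (Finset.univ : Finset (Fin t × L)) // ∀ B ∈ π.parts, B.card = m},
          a₀ (mapPermSub g.1 π) * ∏ B ∈ π.1.parts, coeff (∑ s ∈ B, Finsupp.single s 1)
            (aeval (fun ℓ : L => ∑ k : Fin t, (X (k, ℓ) : MvPolynomial (Fin t × L) ℂ)) f) =
          eval (coeffVec f) q := by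
      intro g
      rw [← hpair₀ f]
      exact Fintype.sum_equiv (mapPermEquiv g.1) _ _ fun π => by
        rw [show mapPermEquiv g.1 π = mapPermSub g.1 π from rfl,
          prod_coeff_indicator_theta_mapPermSub g.1 g.2 π f]
    rw [Finset.sum_congr rfl (fun g _ => hg g), Finset.sum_const, Finset.card_univ, nsmul_eq_mul]

end Summit.ValiantsHypothesis.ValiantsHypothesis.Theorems.SchenstedIndex

end
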